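import Summits.Ventures.Crystal3D.Kissing125.GSearchDefs3
import Summits.Ventures.Crystal3D.Kissing125.GSearchSearch2
import Summits.Ventures.Crystal3D.Kissing125.GSearchRoot2
import HarnessLib

/-!
# Root normalisation and the conclusion from the parts, κ-generic — part 3/4

HONEST FRAMING (cell pub-crystal3d, K-path at `h = 5/4`, V4 = κ as an explicit parameter): this is NOT a result printed
by Hales; it is his METHOD (arXiv:1209.6043, Theorem 3 + Lemmas 7–10, in the tree's form of a verified interval-arithmetic
growth search, `Literature/…/KissingSearch*.lean`) with the largest long-side cosine `κ` made an EXPLICIT PARAMETER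
(`κ : Kappa`, carrying the two numeric facts the soundness proof uses: `-1/2 ≤ κ`, `κ < 1/4`).  Only the declarations
whose statement depends on `κ` are declared here (namespace `…Kissing125.GSearch`, the tree's short names, no renames);
every κ-free helper is the landed K25 copy (`…Kissing125.KissingSearch.*`) and every κ-free lemma is cited from the tree
(PRIVATE per-file citation aliases; `GSearchTransport.lean` holds `toT : St → tree St` and the transport equalities).  The K25
instance is `κ25 = ⟨7/32, …⟩`; `GSearchBridge.lean` identifies the generic checker at
`κ25` with the landed `Kissing125.KissingSearch.checkPart`, so the landed run files are consumed unchanged.  Generated by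
`HOME/lean/kissing125/v4-prep/gen/mkgen.py`; nothing here is asserted about GAP(1.26) or any census.

THIS FILE: the κ-tainted declarations of `Literature/Geometry/DiscreteGeometry/KissingSearchRoot.lean` (part 3 of 4), with `κ : Kappa` threaded; κ-free declarations of that file are NOT re-declared publicly (the κ-free helpers are the landed K25 copies; the κ-free tree lemmas used by the proofs are cited through PRIVATE aliases at the top of the file).

## References
* T. C. Hales, *A proof of Fejes Tóth's conjecture on sphere packings with kissing number twelve*,
  arXiv:1209.6043 (2012): Definition 1, Theorem 2, Theorem 3, Lemmas 7–10. [`Hales2012`]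
* R. E. Moore, *Interval Analysis* (1966), Theorem 3.1, §4.4. [`Moore1966`]
-/

namespace Summit.Ventures.Crystal3D.Kissing125

open Literature.Geometry.DiscreteGeometry
open Summit.Ventures.Crystal3D.Kissing125.KissingSearch

namespace GSearch

open Real Literature.Analysis.ValidatedNumerics KissingLP NonemptyInterval Finset

variable {κ : Kappa}

/-! ### κ-free tree lemmas used below, read over the K25 copies (PRIVATE citation aliases; the public
surface of this file is κ-generic only) -/

/-- K25 reading of the tree lemma `swap_lt_iff` (κ-free; proof = citation of the tree lemma). [folklore] -/
private theorem swap_lt_iff {a b : ℕ} (ha : a < 12) (hb : b < 12) (x : ℕ) :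
  (Equiv.swap a b : ℕ → ℕ) x < 12 ↔ x < 12 :=
  Literature.Geometry.DiscreteGeometry.KissingSearch.swap_lt_iff ha hb x

/-- K25 reading of the tree lemma `validDom_mkR` (κ-free; proof = citation of the tree lemma). [folklore] -/
private theorem validDom_mkR {lo hi : ℕ} (h1 : 1 ≤ lo) (h2 : lo ≤ hi) (h3 : hi ≤ K) :
  ValidDom (mkR lo hi) :=
  Literature.Geometry.DiscreteGeometry.KissingSearch.validDom_mkR h1 h2 h3


section Transport
variable (M : KConf κ)
/-- **Normalisation**: a structure with the same conclusion, in good position at the labels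
`0, 1, 2, 3, 4` and satisfying the root normalisation. [folklore] -/
theorem KConf.exists_good_rootInv : ∃ M' : KConf κ, (M'.Concl → M.Concl) ∧ M'.Good 0 1 2 3 4 ∧ M'.RootInv := by
  classical
  obtain ⟨v₀, p, q, p₃, p₄, G⟩ := M.exists_good
  -- five swaps
  have hv : v₀ < 12 := G.1
  have hσ₁ := swap_lt_iff hv (by norm_num : 0 < 12)
  have G₁ := M.good_relabel (Equiv.swap v₀ 0) hσ₁ G
  rw [Equiv.swap_apply_left] at G₁
  have hp₁ : (Equiv.swap v₀ 0) p < 12 := G₁.2.1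
  have n01 : (0 : ℕ) ≠ (Equiv.swap v₀ 0) p := G₁.2.2.2.2.2.1
  have hσ₂ := swap_lt_iff hp₁ (by norm_num : 1 < 12)
  have G₂ := (M.relabel _ hσ₁).good_relabel (Equiv.swap ((Equiv.swap v₀ 0) p) 1) hσ₂ G₁
  rw [Equiv.swap_apply_left, Equiv.swap_apply_of_ne_of_ne n01 (by norm_num)] at G₂
  -- name the current images
  generalize hq₂ : (Equiv.swap ((Equiv.swap v₀ 0) p) 1) ((Equiv.swap v₀ 0) q) = q₂ at G₂
  generalize hr₂ : (Equiv.swap ((Equiv.swap v₀ 0) p) 1) ((Equiv.swap v₀ 0) p₃) = r₂ at G₂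
  generalize hs₂ : (Equiv.swap ((Equiv.swap v₀ 0) p) 1) ((Equiv.swap v₀ 0) p₄) = s₂ at G₂
  have hq₂lt : q₂ < 12 := G₂.2.2.1
  have n02 : (0 : ℕ) ≠ q₂ := G₂.2.2.2.2.2.2.1
  have n12 : (1 : ℕ) ≠ q₂ := G₂.2.2.2.2.2.2.2.2.2.1
  have hσ₃ := swap_lt_iff hq₂lt (by norm_num : 2 < 12)
  have G₃ := ((M.relabel _ hσ₁).relabel _ hσ₂).good_relabel (Equiv.swap q₂ 2) hσ₃ G₂
  rw [Equiv.swap_apply_left, Equiv.swap_apply_of_ne_of_ne n02 (by norm_num),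
    Equiv.swap_apply_of_ne_of_ne n12 (by norm_num)] at G₃
  generalize hr₃ : (Equiv.swap q₂ 2) r₂ = r₃ at G₃
  generalize hs₃ : (Equiv.swap q₂ 2) s₂ = s₃ at G₃
  have hr₃lt : r₃ < 12 := G₃.2.2.2.1
  have n03 : (0 : ℕ) ≠ r₃ := G₃.2.2.2.2.2.2.2.1
  have n13 : (1 : ℕ) ≠ r₃ := G₃.2.2.2.2.2.2.2.2.2.2.1
  have n23 : (2 : ℕ) ≠ r₃ := G₃.2.2.2.2.2.2.2.2.2.2.2.2.1
  have hσ₄ := swap_lt_iff hr₃lt (by norm_num : 3 < 12)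
  have G₄ := (((M.relabel _ hσ₁).relabel _ hσ₂).relabel _ hσ₃).good_relabel (Equiv.swap r₃ 3) hσ₄ G₃
  rw [Equiv.swap_apply_left, Equiv.swap_apply_of_ne_of_ne n03 (by norm_num),
    Equiv.swap_apply_of_ne_of_ne n13 (by norm_num), Equiv.swap_apply_of_ne_of_ne n23 (by norm_num)] at G₄
  generalize hs₄ : (Equiv.swap r₃ 3) s₃ = s₄ at G₄
  have hs₄lt : s₄ < 12 := G₄.2.2.2.2.1
  have n04 : (0 : ℕ) ≠ s₄ := G₄.2.2.2.2.2.2.2.2.1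
  have n14 : (1 : ℕ) ≠ s₄ := G₄.2.2.2.2.2.2.2.2.2.2.2.1
  have n24 : (2 : ℕ) ≠ s₄ := G₄.2.2.2.2.2.2.2.2.2.2.2.2.2.1
  have n34 : (3 : ℕ) ≠ s₄ := G₄.2.2.2.2.2.2.2.2.2.2.2.2.2.2.1
  have hσ₅ := swap_lt_iff hs₄lt (by norm_num : 4 < 12)
  have G₅ := ((((M.relabel _ hσ₁).relabel _ hσ₂).relabel _ hσ₃).relabel _ hσ₄).good_relabel (Equiv.swap s₄ 4) hσ₅ G₄
  rw [Equiv.swap_apply_left, Equiv.swap_apply_of_ne_of_ne n04 (by norm_num),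
    Equiv.swap_apply_of_ne_of_ne n14 (by norm_num), Equiv.swap_apply_of_ne_of_ne n24 (by norm_num),
    Equiv.swap_apply_of_ne_of_ne n34 (by norm_num)] at G₅
  set M₅ := ((((M.relabel _ hσ₁).relabel _ hσ₂).relabel _ hσ₃).relabel _ hσ₄).relabel _ hσ₅ with hM₅
  have back : M₅.Concl → M.Concl := fun h =>
    M.concl_of_relabel _ hσ₁ ((M.relabel _ hσ₁).concl_of_relabel _ hσ₂ (((M.relabel _ hσ₁).relabel _ hσ₂).concl_of_relabel _ hσ₃
      ((((M.relabel _ hσ₁).relabel _ hσ₂).relabel _ hσ₃).concl_of_relabel _ hσ₄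
        (((((M.relabel _ hσ₁).relabel _ hσ₂).relabel _ hσ₃).relabel _ hσ₄).concl_of_relabel _ hσ₅ h))))
  -- the tie-break, by the reflection `(1 2)(3 4)` if needed
  by_cases htb : ¬ (M₅.ty 0 4 < M₅.ty 0 3 ∨ (M₅.ty 0 3 = M₅.ty 0 4 ∧ M₅.ty 2 4 < M₅.ty 1 3))
  · exact ⟨M₅, back, G₅, G₅.contacts_eq, G₅.longSides_eq, htb⟩
  · push Not at htb
    set τ : Equiv.Perm ℕ := Equiv.swap 1 2 * Equiv.swap 3 4 with hτ
    have τ0 : τ 0 = 0 := by rw [hτ, Equiv.Perm.mul_apply]; decide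
    have τ1 : τ 1 = 2 := by rw [hτ, Equiv.Perm.mul_apply]; decide
    have τ2 : τ 2 = 1 := by rw [hτ, Equiv.Perm.mul_apply]; decide
    have τ3 : τ 3 = 4 := by rw [hτ, Equiv.Perm.mul_apply]; decide
    have τ4 : τ 4 = 3 := by rw [hτ, Equiv.Perm.mul_apply]; decide
    have hτσ : ∀ a, τ a < 12 ↔ a < 12 := by
      intro a; rw [hτ, Equiv.Perm.mul_apply, swap_lt_iff (by norm_num) (by norm_num), swap_lt_iff (by norm_num) (by norm_num)]
    have G₆ := M₅.good_relabel τ hτσ G₅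
    rw [τ0, τ1, τ2, τ3, τ4] at G₆
    have G₆' := (M₅.relabel τ hτσ).good_swap_roles G₆
    refine ⟨M₅.relabel τ hτσ, fun h => back (M₅.concl_of_relabel τ hτσ h), G₆', G₆'.contacts_eq, G₆'.longSides_eq, ?_⟩
    -- the types are exchanged
    have hty : ∀ a b, (M₅.relabel τ hτσ).ty a b = M₅.ty (τ.symm a) (τ.symm b) := fun a b => rfl
    have s0 : τ.symm 0 = 0 := by rw [Equiv.symm_apply_eq]; exact τ0.symm
    have s1 : τ.symm 1 = 2 := by rw [Equiv.symm_apply_eq]; exact τ2.symm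
    have s2 : τ.symm 2 = 1 := by rw [Equiv.symm_apply_eq]; exact τ1.symm
    have s3 : τ.symm 3 = 4 := by rw [Equiv.symm_apply_eq]; exact τ4.symm
    have s4 : τ.symm 4 = 3 := by rw [Equiv.symm_apply_eq]; exact τ3.symm
    rw [hty, hty, hty, hty, s0, s1, s2, s3, s4]
    omega

end Transport

/-! ### Part C. The root states realize; the main abstract theorem -/

section Main

variable {M : KConf κ}

/-- Types are `0` or `1`. [folklore] -/
theorem KConf.ty_le_one (M : KConf κ) (p q : ℕ) : M.ty p q ≤ 1 := by unfold KConf.ty; split_ifs <;> norm_num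

/-- Decoding the bits. [folklore] -/
theorem bitsOf_decode (M : KConf κ) : bitsOf M % 2 = M.ty 0 3 ∧ (bitsOf M / 2) % 2 = M.ty 1 3 ∧
    (bitsOf M / 4) % 2 = M.ty 0 4 ∧ (bitsOf M / 8) % 2 = M.ty 2 4 ∧ bitsOf M < 16 := by
  unfold bitsOf
  have := M.ty_le_one 0 3; have := M.ty_le_one 1 3; have := M.ty_le_one 0 4; have := M.ty_le_one 2 4
  omega

/-- A label pair of a triangle of `M`: the code `if ty = 0 then 0 else FULLR` means the truth.
[folklore] -/
theorem domSem_lab (M : KConf κ) {p q : ℕ} (hp : p < 12) (hq : q < 12) (hpq : p ≠ q) {t : Finset ℕ} (hT : t ∈ M.T)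
    (hpt : p ∈ t) (hqt : q ∈ t) : DomSem κ (if M.ty p q = 0 then 0 else FULLR) (M.g p q) := by
  unfold KConf.ty
  by_cases hg : M.g p q = 1 / 2
  · rw [if_pos hg, if_pos rfl]; exact Or.inr (Or.inl ⟨rfl, hg⟩)
  · rw [if_neg hg, if_neg (by norm_num)]
    refine Or.inr (Or.inr ⟨validDom_mkR le_rfl (by unfold K; norm_num) le_rfl, by unfold FULLR mkR; norm_num, hg, ?_, ?_⟩)
    · rw [show rLo FULLR = 1 by unfold rLo FULLR mkR K; norm_num]
      have : gridPt κ (1 - 1) = -1 / 2 := by unfold gridPt; simp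
      rw [this]
      have := M.side_bound t hT p hpt q hqt hpq
      push_cast; linarith
    · rw [show rHi FULLR = K by unfold rHi FULLR mkR K; norm_num]
      have : gridPt κ K = κ.val := by unfold gridPt K; ring
      rw [this]
      rcases M.dichot p q hp hq hpq with h | ⟨-, h⟩
      · exact absurd h hg
      · exact h

end Main

end GSearch

end Summit.Ventures.Crystal3D.Kissing125
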